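import Summits.BirchSwinnertonDyer.Rank1Residual.AdditivePotMult.QuadraticBaseChangeMilneQuotientOddPart
import Summits.BirchSwinnertonDyer.Rank1Residual.AdditivePotMult.QuadraticBaseChangeOddTamagawaAdditiveAll
import HarnessLib

/-!
# DISCHARGE of the `ord_p`-shaped Milne binder `hWR_p` at odd `p` in rank zero over an imaginary
# quadratic field, on the populations S₁ / S₂ / S₃ (row T-MIL-ODD, FILE C-4b; seat n1011-p01 GEN 6;
# lead GO R5-74 (e))

HONEST FRAMING (cell `b2b-bsdres`, run/shared/lean/b2b/bsd-rank1-residual/, verbatim in every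
file): the goal of the cell is to DELETE the COMBINATION-SHAPED residual classes of the
Birch–Swinnerton-Dyer formula for ALL analytic-rank `≤ 1` elliptic curves over `ℚ` — "full BSD
formula for every rank `≤ 1` curve in class `C`" assembled STRICTLY from published theorems — so
that the rank-`≤ 1` remainder becomes exactly the CONSTRUCTION-SHAPED classes, which are TYPED
(missing-input `Prop`s), NOT attempted. This is not "finishing BSD". Sub-classes X3♯(M) / X4(M)
(additive, potentially multiplicative prime; base-change-and-descend): a RESEARCH ROUTE; they stay
CONSTRUCTION-SHAPED; nothing is booked by this file; no mark / label moved. THEOREMS ONLY: no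
definition, no named fact, no `sorry`.

## What (row T-MIL-ODD, `cells/n1011/skel/T-MIL-ODD.md` §6–§7; lead R5-74 (e))

FILE C-4a (`QuadraticBaseChangeMilneQuotientOddPart`) spelled out the `ord_p`-shaped binder
`hWR_p : ∃ q : ℚ, 0 < q ∧ v_p(q) = 0 ∧ #Ш(W')·Reg(W')·Ω(W')·∏_w c_w(W')/#W'(K)_tors² = q·RHS(W)·RHS(W_d)`
of the cell's base-change-and-descend consumers, proved it equivalent (over all `p`) to Milne's
real identity `hWR`, and reduced it — in RANK ZERO over an IMAGINARY quadratic `K`, `W'(K)` and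
`Ш(W'/K)` finite, `p` odd — to the odd Tamagawa identity
`v_p(|N_{K/ℚ}(u')|·∏c_w(W')) = v_p(|u_d|·∏c(W)·∏c(W_d))` (`milneQuotient_ordp_of_tamagawa`). This
file plugs in the row's three ENDs:

* `milneQuotient_ordp_of_semistable'` — **S₁, EVERY ODD `p`, FACT-FREE** (END #2, FILE C-3f:
  `hS : ∀ v`, `W` good ∨ `W` multiplicative ∨ (`ℓ_v ∣ d_K` ∧ `W_d` multiplicative));
* `milneQuotient_ordp_of_semistable_or_addv` — **S₂, `p ≥ 5`, FACT-FREE** (END #3, FILE C-3g: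
  also `W` additive with `ℓ_v ∤ d_K`, `ℓ_v ≥ 5`);
* `milneQuotient_ordp_of_unramifiedFact` — **S₃, `p ≥ 5`, CONDITIONAL on A233** (END #4, FILE
  C-3h: all additive places prime to `d_K`, GIVEN
  `hA : ∀ v w, kodairaSymbolAt_baseChange_of_ramificationIdx_eq_one K v w W`).

In each: `W/ℚ` globally minimal elliptic, `K` imaginary quadratic with `d_K` odd squarefree (e.g.
`K = ℚ(√−p)`, `p ≡ 3 mod 4`), globally minimal `W_d = C_d • W^{(d_K)}` and `W' = C' • W_K`, `W'(K)`
finite (FILE C-4a `finite_point_of_finite_of_finite_twist` gives it from `W(ℚ)`, `W_d(ℚ)` finite)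
and `Ш(W'/K)` finite. So for the X3♯(M)/X4(M) consumers at the additive prime `p ≡ 3 (mod 4)` with
BOTH `W`, `W^{(−p)}` of analytic rank `0`, on S₁ (`p ≥ 3`) / S₂ (`p ≥ 5`): **`hWR_p` at `p` is a
THEOREM — the named fact A65 is not consumed there.** HONEST LIMITS: RANK ZERO and IMAGINARY `K`
only (positive rank needs the regulator comparison and the odd `Ш`/Selmer comparison with infinite
Mordell–Weil groups; real `K` the archimedean comparison at two real places — none in the tree, not
attempted); `Ш(W'/K)` finite is a HYPOTHESIS (A65's other conclusion; not discharged); odd `p` /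
`p ≥ 5` as displayed; S₃ CONDITIONAL on `hA`; consumers switch binders by THEIR OWN append; TOOL
theorems; closes no class; moves no mark; discharges no named fact.
-/

noncomputable section

open scoped Classical NumberField

open WeierstrassCurve NumberField IsDedekindDomain Rat.HeightOneSpectrum
  Literature.NumberTheory.EllipticCurves Literature.NumberTheory.DiophantineGeometry

namespace Summit.BirchSwinnertonDyer.Rank1Residual.AdditivePotMult

/-! ## The three discharges -/

section Discharge

variable (W : WeierstrassCurve ℚ) [W.IsElliptic] [W.IsGloballyMinimal] (K : Type) [Field K]
  [NumberField K] [IsTotallyComplex K] (Wd : WeierstrassCurve ℚ) [Wd.IsElliptic]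
  [Wd.IsGloballyMinimal] (W' : WeierstrassCurve K) [W'.IsElliptic] [W'.IsGloballyMinimal]

/-- **DISCHARGE of `hWR_p` on S₁, EVERY ODD `p`, rank zero, imaginary `K`, FACT-FREE.** For
`W/ℚ` globally minimal elliptic, `K` imaginary quadratic with `d_K` odd squarefree (e.g.
`K = ℚ(√−p)`, `p ≡ 3 mod 4`), globally minimal `W_d = C_d • W^{(d_K)}` and `W' = C' • W_K` with
`W'(K)` and `Ш(W'/K)` finite, and `hS : ∀ v`, `W` good ∨ `W` multiplicative ∨ (`ℓ_v ∣ d_K` ∧ `W_d`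
multiplicative), every odd prime `p`:
`∃ q ∈ ℚ_{>0}, v_p(q) = 0 ∧ #Ш(W')·Reg(W')·Ω(W')·∏c_w(W')/#W'(K)_tors² = q·RHS(W)·RHS(W_d)` — from
END #2 (`padicValRat_norm_mul_tamagawaProduct_eq_of_semistable'`, FILE C-3f). No named fact.
[cite: Milne1972ArithmeticAV, §1 Thm. 1 and §2 (through DokchitserDokchitserAnnals2010, §2.1, proof of Thm. 8)] -/
theorem milneQuotient_ordp_of_semistable' (h2 : Module.finrank ℚ K = 2)
    (hdodd : Odd (NumberField.discr K)) (hdsq : Squarefree (NumberField.discr K))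
    {Cd : VariableChange ℚ} (hWd : Cd • W.quadraticTwist (NumberField.discr K : ℚ) = Wd)
    {C' : VariableChange K} (hW' : C' • W.baseChange K = W') [Finite W'.toAffine.Point]
    (hsha : W'.ShaFinite)
    (hS : ∀ v : HeightOneSpectrum (𝓞 ℚ), W.HasGoodReductionAt v ∨ W.HasMultiplicativeReductionAt v ∨
      (((primesEquiv v : ℕ) : ℤ) ∣ NumberField.discr K ∧ Wd.HasMultiplicativeReductionAt v))
    (p : ℕ) [hp : Fact p.Prime] (hp2 : p ≠ 2) :
    ∃ q : ℚ, 0 < q ∧ padicValRat p q = 0 ∧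
      (W'.shaOrder : ℝ) * W'.regulator * W'.bsdPeriod * (W'.tamagawaProduct : ℝ) /
          (W'.torsionOrder : ℝ) ^ 2 = (q : ℝ) * (W.bsdRHS * Wd.bsdRHS) :=
  milneQuotient_ordp_of_tamagawa W K Wd W' h2 hWd hW' hsha p hp2
    (padicValRat_norm_mul_tamagawaProduct_eq_of_semistable' W K Wd W' h2 hdodd hdsq hWd hW' hS p hp2)

/-- **DISCHARGE of `hWR_p` on S₂, `p ≥ 5`, rank zero, imaginary `K`, FACT-FREE**: as
`milneQuotient_ordp_of_semistable'` with additive places of residue characteristic `≥ 5` prime to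
`d_K` allowed in `hS` — from END #3 (`padicValRat_norm_mul_tamagawaProduct_eq_of_semistable_or_addv`,
FILE C-3g). No named fact. [cite: Milne1972ArithmeticAV, §1 Thm. 1 and §2 (through DokchitserDokchitserAnnals2010, §2.1, proof of Thm. 8)] -/
theorem milneQuotient_ordp_of_semistable_or_addv (h2 : Module.finrank ℚ K = 2)
    (hdodd : Odd (NumberField.discr K)) (hdsq : Squarefree (NumberField.discr K))
    {Cd : VariableChange ℚ} (hWd : Cd • W.quadraticTwist (NumberField.discr K : ℚ) = Wd)
    {C' : VariableChange K} (hW' : C' • W.baseChange K = W') [Finite W'.toAffine.Point]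
    (hsha : W'.ShaFinite)
    (hS : ∀ v : HeightOneSpectrum (𝓞 ℚ), W.HasGoodReductionAt v ∨ W.HasMultiplicativeReductionAt v ∨
      (((primesEquiv v : ℕ) : ℤ) ∣ NumberField.discr K ∧ Wd.HasMultiplicativeReductionAt v) ∨
      (W.HasAdditiveReductionAt v ∧ ¬ ((primesEquiv v : ℕ) : ℤ) ∣ NumberField.discr K ∧
        5 ≤ (primesEquiv v : ℕ)))
    (p : ℕ) [hp : Fact p.Prime] (hp5 : 5 ≤ p) :
    ∃ q : ℚ, 0 < q ∧ padicValRat p q = 0 ∧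
      (W'.shaOrder : ℝ) * W'.regulator * W'.bsdPeriod * (W'.tamagawaProduct : ℝ) /
          (W'.torsionOrder : ℝ) ^ 2 = (q : ℝ) * (W.bsdRHS * Wd.bsdRHS) :=
  milneQuotient_ordp_of_tamagawa W K Wd W' h2 hWd hW' hsha p (by omega)
    (padicValRat_norm_mul_tamagawaProduct_eq_of_semistable_or_addv W K Wd W' h2 hdodd hdsq hWd hW'
      hS p hp5)

/-- **DISCHARGE of `hWR_p` on S₃, `p ≥ 5`, rank zero, imaginary `K`, CONDITIONAL on A233**: as
above with ALL additive places prime to `d_K` allowed in `hS`, GIVEN the named fact A233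
`kodairaSymbolAt_baseChange_of_ramificationIdx_eq_one` at every `(v, w)` as hypothesis `hA` — from
END #4 (`padicValRat_norm_mul_tamagawaProduct_eq_of_unramifiedFact`, FILE C-3h). CONDITIONAL on
`hA`; no fact discharged. [cite: Milne1972ArithmeticAV, §1 Thm. 1 and §2 (through DokchitserDokchitserAnnals2010, §2.1, proof of Thm. 8)] [cite: SilvermanAEC2009, Prop. VII.5.4 (a)] -/
theorem milneQuotient_ordp_of_unramifiedFact (h2 : Module.finrank ℚ K = 2)
    (hdodd : Odd (NumberField.discr K)) (hdsq : Squarefree (NumberField.discr K))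
    {Cd : VariableChange ℚ} (hWd : Cd • W.quadraticTwist (NumberField.discr K : ℚ) = Wd)
    {C' : VariableChange K} (hW' : C' • W.baseChange K = W') [Finite W'.toAffine.Point]
    (hsha : W'.ShaFinite)
    (hA : ∀ (v : HeightOneSpectrum (𝓞 ℚ)) (w : HeightOneSpectrum (𝓞 K)),
      kodairaSymbolAt_baseChange_of_ramificationIdx_eq_one K v w W)
    (hS : ∀ v : HeightOneSpectrum (𝓞 ℚ), W.HasGoodReductionAt v ∨ W.HasMultiplicativeReductionAt v ∨
      (((primesEquiv v : ℕ) : ℤ) ∣ NumberField.discr K ∧ Wd.HasMultiplicativeReductionAt v) ∨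
      (W.HasAdditiveReductionAt v ∧ ¬ ((primesEquiv v : ℕ) : ℤ) ∣ NumberField.discr K))
    (p : ℕ) [hp : Fact p.Prime] (hp5 : 5 ≤ p) :
    ∃ q : ℚ, 0 < q ∧ padicValRat p q = 0 ∧
      (W'.shaOrder : ℝ) * W'.regulator * W'.bsdPeriod * (W'.tamagawaProduct : ℝ) /
          (W'.torsionOrder : ℝ) ^ 2 = (q : ℝ) * (W.bsdRHS * Wd.bsdRHS) :=
  milneQuotient_ordp_of_tamagawa W K Wd W' h2 hWd hW' hsha p (by omega)
    (padicValRat_norm_mul_tamagawaProduct_eq_of_unramifiedFact W K Wd W' h2 hdodd hdsq hWd hW' hA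
      hS p hp5)

end Discharge

end Summit.BirchSwinnertonDyer.Rank1Residual.AdditivePotMult

end
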